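import Summits.QuantumFields.YangMills.Theorems.AlphaInputsT3ACv3StepLowCharge
import Summits.QuantumFields.YangMills.Theorems.AlphaInputsT3ACAvgFunLocalLowerDensity
import HarnessLib

/-!
# `AlphaInputsT3ACChargeOfDeepFibrePoint` — THE CHARGING LETTER `hcharge` OF THE LOWER ROW (#23 `fibre57LowOn`) AT THE T³ RECORD, REDUCED TO THE DEEP-FIBRE-POINT LETTER
# «`lo (k+1) ⊆ Ū″{χB_k(triv′) ≠ 0}`» (cell `ym3-torus`, ★★OWNER g35 RECORD 17cm residue `{hcharge ⟸ (L1) (L2) (L3) (L4)}`; seat `ym-ust-19936-w8` g16, TWIN-WIDTH helper;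
# `--supports stmt-QuantumFields-19936 --as helper`; file B of 2 — the generic measure theory (L2)+(L3)+(L4) is the sibling ✓`…AlphaInputsT3ACAvgFunLocalLowerDensity`; the (L1) letter is
# `ym3-torus-px20` g13's)

WHAT.  ✓`PinnedStepTrivPins.fibre57LowOnAC_T3_of_le_gamma_of_hcharge` (✓`…AlphaInputsT3ACv3StepLowCharge`) proves the lower step row R3D-02χ at the T³ record modulo, among displayed
letters, the chart-free CHARGING letter `hcharge`: «a measurable `N ⊆ lo (k+1)` with `dU (O_ε ∩ {χB_k(triv′) ≠ 0} ∩ Ū⁻¹ N) = 0` is `dV`-null» (`O_ε` the small-loop region of radius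
`ε_P = |Idx (F.P K)|⁻¹∕10 = (360·L³)⁻¹`).  The sibling file's ★★★ `AvgFunLocalLowerDensity.charge_of_deepFibrePoints` gives that shape at every lattice from a deep-fibre-point
letter WITH a loop-guard conjunct, under the three N09 guard conditions on the loop radius.  THIS FILE specialises to the record:
* §1 the three N09 conditions hold for `ε_P = (360·L³)⁻¹` at every `L ≥ 1`: `chartRadius_T3_le_inv24` (`≤ 1∕24`), `chartRadius_T3_lt_deltaSU2` (`< δ_{SU(2)} = min (1∕3) (π∕2)`),
  `chartRadius_T3_N09` (`157·ε_P < L^{1−d} = L⁻²`);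
* §2 ★★★ `hcharge_of_deepFibrePoints` — ✓p774960's `hcharge` binder VERBATIM ⟸ the size line `hγs` + `k ≤ K` + the χB-ONLY deep-fibre-point letter
  `hdeep : ∀ V ∈ lo (k+1), ∃ U₀, Ū U₀ = V ∧ χB_k(triv′)(U₀) ≠ 0` (the loop conjunct is discharged: `{χB_k(triv′) ≠ 0} ⊆ O_ε` on the size line, ✓`loopSmall_of_chiB_triv_ne_zero` ∘
  ✓`sizeLine_T3_of_le_gamma`); ★★★ `fibre57LowOnAC_T3_of_le_gamma_of_deepFibrePoints` = ✓`fibre57LowOnAC_T3_of_le_gamma_of_hcharge` with `hcharge ↦ hdeep`.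
AFTER THIS FILE the #23 residue of RECORD 17cm reads `{hdeep = (L1): r1's fibre membership + the sharp symmetric Prop. 2 ✓`BlockAveragingEMLProp2.plaqSmall_iter_blockAvg_eml` (px20 g13),
B0's (55)∕(58) pins, hinv}` (+ `hdom`∕`hloinv` at print's `c = 1`).

HONEST SCOPE.  Bookkeeping over the sibling file and the lineage's size line; def-free; no topology is elaborated in this file (see the sibling's module docstring); nothing of
[Balaban1985UV3] (37)∕(47)∕(57), of row #23, of the (α) data rows (0∕23), of (O‴χₛ), `HistoryTailL` (19936), EX, LOWB∘ or `YM3TorusSU2` is proved (rung R3 = SU(2) YM₃ on T³, a RECORD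
rung: NOT d = 4, NOT infinite volume, NOT a mass gap, NOT Clay; the Yang–Mills mass gap is NOT proved).  L-floor: none (`1 < L` of `T3Family`).
References: T. Bałaban, Commun. Math. Phys. **102** (1985) 255–275 [Balaban1985UV3] ((37) p.265, (47) p.267, (49)–(58) pp.268–270, p.272 L32–33); **109** (1987) 249–301
[Balaban1987RG1] ((0.4) p.253).
-/

set_option autoImplicit false

noncomputable section

namespace Summit.QuantumFields.YangMills.Theorems.PinnedStepTrivPins

open MeasureTheory Set Literature.MathematicalPhysics.QuantumFieldTheory.Balaban1983to89
open Literature.MathematicalPhysics.QuantumFieldTheory.Balaban1983to89.GaugeField (GaugeInvariant gaugeAct)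
open Literature.MathematicalPhysics.QuantumFieldTheory.Balaban1983to89.BlockAveraging (avgFun loopHol Idx measurable_avgFun)
open Literature.MathematicalPhysics.QuantumFieldTheory.Balaban1983to89.ExpMeanLog (expMeanLogSU measurable_expMeanLogSU_E deltaSU)
open Literature.MathematicalPhysics.QuantumFieldTheory.Balaban1983to89.T3ContinuumYM3Torus (T3Family)
open Literature.MathematicalPhysics.QuantumFieldTheory.Balaban1985CMP102 Literature.MathematicalPhysics.QuantumFieldTheory.Balaban1985CMP102.Setting
open Summit.QuantumFields.Balaban3D.Carriers
open Summit.QuantumFields.Balaban3D.Proofs.Primitives (AlphaConsts)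
open Summit.QuantumFields.Balaban3D.Proofs.TowerAC Summit.QuantumFields.Balaban3D.Proofs.StandardAC Summit.QuantumFields.Balaban3D.Proofs.InputsAC
open Summit.QuantumFields.Balaban3D.Proofs.Bound55Masses (chiB chiB_nonneg chiB_le_one measurable_chiB)
open Summit.QuantumFields.Balaban3D.Proofs.GaussianNormalization (partZ normalized integral_exp_neg_mul_eq)
open Summit.QuantumFields.Balaban3D.Proofs.Thresholds (Q0 Q0_pos)
open Summit.QuantumFields.YangMills.Theorems.PinnedStep (Fibre57LowOnAC)
open Summit.QuantumFields.YangMills.Theorems.BlockAvgEMLWeightedFibreChart (loopSmall_of_chiB_triv_ne_zero)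
open Summit.QuantumFields.YangMills.Theorems.AvgFunLocalLowerDensity (charge_of_deepFibrePoints)
open scoped NNReal ENNReal

/-! ## §1 The three N09 guard conditions at the radius `ε_P = (360·L³)⁻¹` -/

section Numerics

variable (F : T3Family) (K : ℕ)

/-- `ε_P = (360·L³)⁻¹ ≤ 1∕24`. [folklore] -/
theorem chartRadius_T3_le_inv24 : ((Fintype.card (Idx (F.P K)) : ℝ))⁻¹ / 10 ≤ 1 / 24 := by
  rw [chartRadius_T3_eq, one_div]
  have hL1 : (1 : ℝ) ≤ F.L := by exact_mod_cast F.hL.2.le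
  have hL3 : (1 : ℝ) ≤ (F.L : ℝ) ^ 3 := one_le_pow₀ hL1
  exact inv_anti₀ (by norm_num) (by nlinarith)

/-- `ε_P = (360·L³)⁻¹ < δ_{SU(2)} = min (1∕3) (π∕2)`. [folklore] -/
theorem chartRadius_T3_lt_deltaSU2 : ((Fintype.card (Idx (F.P K)) : ℝ))⁻¹ / 10 < deltaSU (Fin 2) := by
  rw [chartRadius_T3_eq]
  have hL1 : (1 : ℝ) ≤ F.L := by exact_mod_cast F.hL.2.le
  have hL3 : (1 : ℝ) ≤ (F.L : ℝ) ^ 3 := one_le_pow₀ hL1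
  have h1 : (360 * (F.L : ℝ) ^ 3)⁻¹ ≤ (360 : ℝ)⁻¹ := inv_anti₀ (by norm_num) (by nlinarith)
  have hπ : (3 : ℝ) < Real.pi := Real.pi_gt_three
  unfold deltaSU
  rw [Fintype.card_fin]
  refine lt_min (by linarith) ?_
  push_cast
  rw [lt_div_iff₀ (by norm_num : (0 : ℝ) < 2)]
  linarith

/-- `157·ε_P < L^{1−d}` at `d = 3`: `157·(360·L³)⁻¹ < (L²)⁻¹` for every `L ≥ 1`. [folklore] -/
theorem chartRadius_T3_N09 : 157 * (((Fintype.card (Idx (F.P K)) : ℝ))⁻¹ / 10) < ((((F.P K).L : ℝ)) ^ ((F.P K).d - 1))⁻¹ := by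
  rw [chartRadius_T3_eq, T3Family.P_d, show (F.P K).L = F.L from rfl]
  have hL1 : (1 : ℝ) ≤ F.L := by exact_mod_cast F.hL.2.le
  have hL : (0 : ℝ) < F.L := by positivity
  have h360 : (0 : ℝ) < 360 * (F.L : ℝ) ^ 3 := by positivity
  show (157 : ℝ) * (360 * (F.L : ℝ) ^ 3)⁻¹ < ((F.L : ℝ) ^ 2)⁻¹
  rw [show (157 : ℝ) * (360 * (F.L : ℝ) ^ 3)⁻¹ = 157 / (360 * (F.L : ℝ) ^ 3) from by ring,
    show (((F.L : ℝ)) ^ 2)⁻¹ = 1 / (F.L : ℝ) ^ 2 from (one_div _).symm, div_lt_div_iff₀ h360 (by positivity)]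
  nlinarith

end Numerics

/-! ## §2 `hcharge` ⟸ the deep-fibre-point letter, and the lower row with `hcharge ↦ hdeep` -/

section Record

variable {F : T3Family} (𝔠 : AlphaConsts F.L (suGroupModel 2).N) {γ : ℝ} {hγ : 0 < γ} {hγ1' : γ ≤ 1} {K : ℕ}
  {Val : Type} [NormedAddCommGroup Val] [NormedSpace ℂ Val]
  (X : ExternalInputsAC (T3Scales F γ hγ hγ1' K) (Matrix.specialUnitaryGroup (Fin 2) ℂ))
  (𝔖 : ∀ k, StepSeries (T3Scales F γ hγ hγ1' K) (Matrix.specialUnitaryGroup (Fin 2) ℂ) Val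
    (nblkOf (T3Scales F γ hγ hγ1' K) 𝔠.lane.carrier k) k)

/-- ★★★ **THE CHARGING LETTER `hcharge` OF THE LOWER ROW FROM THE DEEP-FIBRE-POINT LETTER.**  At the T³ record on the size line (`hγs`), for a left family `lo` and a level
`k ≤ K`: IF every `V ∈ lo (k+1)` is the block average `Ū(U₀)` of SOME level-`k` configuration `U₀` in the trivial-history window `{χB_k(triv′) ≠ 0}` (`hdeep` — print's reason for
putting χ on the minimiser, [Balaban1985UV3] (47) p.267: the χ^min point `(blockAvg ℰp)^k Ũ` of the fibre does it, by the sharp symmetric Prop. 2), THEN ✓p774960's `hcharge` holds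
VERBATIM: a measurable `N ⊆ lo (k+1)` with `dU (O_ε ∩ {χB_k(triv′) ≠ 0} ∩ Ū⁻¹N) = 0` is `dV`-null.  Proof: `{χB ≠ 0} ⊆ O_ε` on the size line (✓`loopSmall_of_chiB_triv_ne_zero`,
✓`sizeLine_T3_of_le_gamma`), the radius `ε_P = (360·L³)⁻¹` meets the three N09 conditions (§1), and the sibling's ★★★ `AvgFunLocalLowerDensity.charge_of_deepFibrePoints` applies at
`P := F.P K`, `N = 2`, `ε := ε_P`. [cite: Balaban1985UV3, (47) p.267 + (49)–(58) pp.268–270 + p.272 L32–33] [cite: Balaban1987RG1, (0.4) p.253] -/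
theorem hcharge_of_deepFibrePoints (hγs : γ ≤ ((((4500 : ℝ) * (F.L : ℝ) ^ 5)⁻¹ / (𝔠.b₀ * Q0 𝔠.p₀)) ^ 2) ^ 2)
    (lo : (k : ℕ) → Set (GaugeField (F.P K) k (Matrix.specialUnitaryGroup (Fin 2) ℂ))) (k : ℕ) (hk : k ≤ K)
    (hdeep : ∀ V ∈ lo (k + 1), ∃ U₀ : GaugeField (F.P K) k (Matrix.specialUnitaryGroup (Fin 2) ℂ),
      avgFun (expMeanLogSU (n := Fin 2)) U₀ = V ∧
        chiB 𝔠.lane.carrier.M₁ (rcolOf (T3Scales F γ hγ hγ1' K) 𝔠.lane.carrier) (eps1Of (T3Scales F γ hγ hγ1' K) 𝔠.lane.carrier) k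
          (Hist.triv (F.P K) (k + 1)) U₀ ≠ 0) :
    ∀ Nset : Set (GaugeField (F.P K) (k + 1) (Matrix.specialUnitaryGroup (Fin 2) ℂ)), MeasurableSet Nset → Nset ⊆ lo (k + 1) →
      fieldMeasure (F.P K) k (Matrix.specialUnitaryGroup (Fin 2) ℂ)
        ({U : GaugeField (F.P K) k (Matrix.specialUnitaryGroup (Fin 2) ℂ) | ∀ c i, dist1 (loopHol U c i) < ((Fintype.card (Idx (F.P K)) : ℝ))⁻¹ / 10} ∩
          {U | chiB 𝔠.lane.carrier.M₁ (rcolOf (T3Scales F γ hγ hγ1' K) 𝔠.lane.carrier) (eps1Of (T3Scales F γ hγ hγ1' K) 𝔠.lane.carrier) k (Hist.triv (F.P K) (k + 1)) U ≠ 0} ∩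
          (avgFun (expMeanLogSU (n := Fin 2))) ⁻¹' Nset) = 0 →
      fieldMeasure (F.P K) (k + 1) (Matrix.specialUnitaryGroup (Fin 2) ℂ) Nset = 0 := by
  intro Nset hN hNlo h0
  -- the size line: `0 ≤ ε₁(k)` and `((d+2)L)²ε₁(k)/4 < ε_P`
  obtain ⟨hεS, hwin⟩ := sizeLine_T3_of_le_gamma (𝔠 := 𝔠) γ hγ hγ1' hγs K k hk
  -- the standing range
  have hj : k + 1 ≤ (F.P K).m + (F.P K).K := by
    have hm := F.hm
    show k + 1 ≤ F.m + K
    omega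
  -- the sibling's generic charge theorem at `ε := ε_P`, the loop conjunct supplied by the window inclusion `{χB ≠ 0} ⊆ O_ε`
  exact charge_of_deepFibrePoints (P := F.P K) (j := k) (N := 2) hj (chartRadius_T3_le_inv24 F K) (chartRadius_T3_lt_deltaSU2 F K)
    (chartRadius_T3_N09 F K) 𝔠.lane.carrier.M₁ (rcolOf (T3Scales F γ hγ hγ1' K) 𝔠.lane.carrier) (eps1Of (T3Scales F γ hγ hγ1' K) 𝔠.lane.carrier)
    (L := lo (k + 1))
    (fun V hV => by
      obtain ⟨U₀, hU₀V, hχ⟩ := hdeep V hV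
      exact ⟨U₀, hU₀V, loopSmall_of_chiB_triv_ne_zero _ _ _ k hεS hwin U₀ hχ, hχ⟩)
    Nset hN hNlo h0

/-- ★★★ **THE LOWER ROW `Fibre57LowOnAC` AT THE T³ RECORD WITH THE CHARGING LETTER REPLACED BY THE DEEP-FIBRE-POINT LETTER** — ✓`fibre57LowOnAC_T3_of_le_gamma_of_hcharge`
(✓`…AlphaInputsT3ACv3StepLowCharge`) VERBATIM except `hcharge ↦ hdeep : ∀ V ∈ lo (k+1), ∃ U₀, Ū U₀ = V ∧ χB_k(triv′)(U₀) ≠ 0`.  After this edition the lower row at the T³ record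
displays, besides the chart binders and the data rows: the (55)∕(58) PINS of `𝔖` (B0), `hinv`, the level-`k` family letters `hlom`∕`hloinv`∕`hdom`, `hlom₁`, and the DEEP-FIBRE-POINT
letter `hdeep` (r1's fibre membership + the sharp symmetric Prop. 2 ✓`BlockAveragingEMLProp2.plaqSmall_iter_blockAvg_eml`; 19936 evidence #57, px20 g13's (L1)).
[cite: Balaban1985UV3, (37) p.265 + (47) p.267 + (55)–(58) pp.269–270 + p.272 L32–33] -/
theorem fibre57LowOnAC_T3_of_le_gamma_of_deepFibrePoints (hγs : γ ≤ ((((4500 : ℝ) * (F.L : ℝ) ^ 5)⁻¹ / (𝔠.b₀ * Q0 𝔠.p₀)) ^ 2) ^ 2)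
    (lo : (k : ℕ) → Set (GaugeField (F.P K) k (Matrix.specialUnitaryGroup (Fin 2) ℂ))) (k : ℕ) (hk : k ≤ K)
    (hav : (X.av k).avg = avgFun (expMeanLogSU (n := Fin 2)))
    (Φ : GaugeField (F.P K) (k + 1) (Matrix.specialUnitaryGroup (Fin 2) ℂ) × GaugeField (F.P K) k (Matrix.specialUnitaryGroup (Fin 2) ℂ) →
      GaugeField (F.P K) k (Matrix.specialUnitaryGroup (Fin 2) ℂ))
    (J : GaugeField (F.P K) (k + 1) (Matrix.specialUnitaryGroup (Fin 2) ℂ) × GaugeField (F.P K) k (Matrix.specialUnitaryGroup (Fin 2) ℂ) → ℝ≥0)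
    (T : Set (GaugeField (F.P K) (k + 1) (Matrix.specialUnitaryGroup (Fin 2) ℂ) × GaugeField (F.P K) k (Matrix.specialUnitaryGroup (Fin 2) ℂ)))
    (hΦ : Measurable Φ) (hJ : Measurable J) (hT : MeasurableSet T)
    (hmap : ((((fieldMeasure (F.P K) (k + 1) (Matrix.specialUnitaryGroup (Fin 2) ℂ)).prod
        (fieldMeasure (F.P K) k (Matrix.specialUnitaryGroup (Fin 2) ℂ))).restrict T).withDensity (fun z => (J z : ℝ≥0∞))).map Φ =
      (fieldMeasure (F.P K) k (Matrix.specialUnitaryGroup (Fin 2) ℂ)).restrict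
        {U : GaugeField (F.P K) k (Matrix.specialUnitaryGroup (Fin 2) ℂ) |
          ∀ c i, dist1 (loopHol U c i) < ((Fintype.card (Idx (F.P K)) : ℝ))⁻¹ / 10})
    (hfib : ∀ z ∈ T, avgFun (expMeanLogSU (n := Fin 2)) (Φ z) = z.1) (N lσ dg : ℝ)
    (q : GaugeField (F.P K) (k + 1) (Matrix.specialUnitaryGroup (Fin 2) ℂ) → GaugeField (F.P K) k (Matrix.specialUnitaryGroup (Fin 2) ℂ) → ℝ)
    (hqm : ∀ V, Measurable (q V)) (hZ : ∀ V, 0 < partZ (fieldMeasure (F.P K) k (Matrix.specialUnitaryGroup (Fin 2) ℂ)) (q V))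
    (hU : Measurable (X.UkH k (Hist.triv (F.P K) k))) (hPm : Measurable ((inputOfAC 𝔠.lane X 𝔖).Pint k (Hist.triv (F.P K) k)))
    (cP : ℝ) (hPb : ∀ U, (inputOfAC 𝔠.lane X 𝔖).Pint k (Hist.triv (F.P K) k) U ≤ cP)
    (hinv : GaugeInvariant (fun U : GaugeField (F.P K) k (Matrix.specialUnitaryGroup (Fin 2) ℂ) =>
      Real.exp (-((towerOfAC 𝔠.lane X 𝔖).mainT k (Hist.triv (F.P K) k) U) + (towerOfAC 𝔠.lane X 𝔖).Pint k (Hist.triv (F.P K) k) U)))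
    (hlom : MeasurableSet (lo k))
    (hloinv : ∀ (u : GaugeTransf (F.P K) k (Matrix.specialUnitaryGroup (Fin 2) ℂ)) (U : GaugeField (F.P K) k (Matrix.specialUnitaryGroup (Fin 2) ℂ)),
      gaugeAct u U ∈ lo k ↔ U ∈ lo k)
    (hdom : ∀ U : GaugeField (F.P K) k (Matrix.specialUnitaryGroup (Fin 2) ℂ),
      chiB 𝔠.lane.carrier.M₁ (rcolOf (T3Scales F γ hγ hγ1' K) 𝔠.lane.carrier) (eps1Of (T3Scales F γ hγ hγ1' K) 𝔠.lane.carrier) k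
        (Hist.triv (F.P K) (k + 1)) U ≠ 0 → U ∈ lo k)
    (hσ : (piecesAC 𝔠.lane X 𝔖 k).logσ₀ = lσ) (hdg : (piecesAC 𝔠.lane X 𝔖 k).dg = dg)
    (hstar : (piecesAC 𝔠.lane X 𝔖 k).starB (Hist.triv (F.P K) (k + 1)) = N)
    (hZU : ∀ V, (piecesAC 𝔠.lane X 𝔖 k).logZU (Hist.triv (F.P K) (k + 1)) V =
      Real.log (partZ (fieldMeasure (F.P K) k (Matrix.specialUnitaryGroup (Fin 2) ℂ)) (q V)))
    (hFl : ∀ V, (piecesAC 𝔠.lane X 𝔖 k).logFl (Hist.triv (F.P K) (k + 1)) V =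
      Real.log (∫ U', (Real.exp (-((lσ + dg * Real.log ((T3Scales F γ hγ hγ1' K).gk k)) * N)) * T.indicator (fun z => (J z : ℝ)) (V, U')) *
              chiB 𝔠.lane.carrier.M₁ (rcolOf (T3Scales F γ hγ hγ1' K) 𝔠.lane.carrier) (eps1Of (T3Scales F γ hγ hγ1' K) 𝔠.lane.carrier) k
                (Hist.triv (F.P K) (k + 1)) (Φ (V, U')) *
              Real.exp (-((towerOfAC 𝔠.lane X 𝔖).mainT k (Hist.triv (F.P K) k) (Φ (V, U')) -
                    (towerOfAC 𝔠.lane X 𝔖).mainT (k + 1) (Hist.triv (F.P K) (k + 1)) V)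
                + ((towerOfAC 𝔠.lane X 𝔖).Pint k (Hist.triv (F.P K) k) (Φ (V, U')) - (piecesAC 𝔠.lane X 𝔖 k).Pold (Hist.triv (F.P K) (k + 1)) V)
                + q V U')
            ∂(normalized (fieldMeasure (F.P K) k (Matrix.specialUnitaryGroup (Fin 2) ℂ)) (q V))))
    (hlom₁ : MeasurableSet (lo (k + 1)))
    (hdeep : ∀ V ∈ lo (k + 1), ∃ U₀ : GaugeField (F.P K) k (Matrix.specialUnitaryGroup (Fin 2) ℂ),
      avgFun (expMeanLogSU (n := Fin 2)) U₀ = V ∧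
        chiB 𝔠.lane.carrier.M₁ (rcolOf (T3Scales F γ hγ hγ1' K) 𝔠.lane.carrier) (eps1Of (T3Scales F γ hγ hγ1' K) 𝔠.lane.carrier) k
          (Hist.triv (F.P K) (k + 1)) U₀ ≠ 0) :
    Fibre57LowOnAC 𝔠.lane X 𝔖 lo k :=
  fibre57LowOnAC_T3_of_le_gamma_of_hcharge 𝔠 X 𝔖 hγs lo k hk hav Φ J T hΦ hJ hT hmap hfib N lσ dg q hqm hZ hU hPm cP hPb hinv hlom hloinv
    hdom hσ hdg hstar hZU hFl hlom₁ (hcharge_of_deepFibrePoints 𝔠 hγs lo k hk hdeep)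

end Record

end Summit.QuantumFields.YangMills.Theorems.PinnedStepTrivPins

end
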